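import Literature.NumberTheory.EllipticCurves.SingularModuliClassGroupAction
import Literature.NumberTheory.EllipticCurves.HeegnerPointsRationalityProofs
import HarnessLib

/-!
# Discharge of `heegnerPoints_shimuraReciprocity` (Darmon 2004 Thms. 3.3/3.6/3.7; Gross 1984 §I.1, (4.2);
# Gross–Zagier 1986 II §1): the class-group-structured Galois action on the Heegner points of conductor `1`

Topic `NumberTheory/EllipticCurves`. Cell `bsd-goldfeld`, typer seat `bsd-goldfeld-ty` (gen 13), planner ruling g31
(cxli) ADDENDUM (4b) = ROADMAP §14.6 (R4) of the cell memo. THEOREMS ONLY (no definition, no named fact; net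
Literature debt `−1`: the fact `Literature.NumberTheory.EllipticCurves.heegnerPoints_shimuraReciprocity` of
`HeegnerPointsShimuraReciprocity.lean` becomes a theorem).

## The proof (all inputs are tree theorems)

* the lifts `P_Q ∈ E(H_K)` of `φ(τ_Q)`, `Q ∈ H.reps` — Darmon Thm. 3.6, the tree's
  `exists_point_of_isAutEquivariantOnHeegner` fed with the `Aut(ℂ)`-equivariance of every datum
  (`ModularParametrizationData.isAutEquivariantOnHeegner`, `HeegnerPointsRationalityProofs.lean`);
* the isomorphism `θ := η⁻¹ : Cl(𝒪_{d_K}) ≃* Gal(H_K/K)` — Hasse's `η` (`galClassEquiv`,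
  `SingularModuliClassGroupAction.lean`: `η(s)` is the class with `s(j(𝒪_K)) = j(η(s))`, and `s(j(κ)) = j(η(s)κ)` for
  all classes `κ`, built without class field theory from the transport of level structures at auxiliary levels);
* the transport law `θ(γ) P_Q = P_{Q'}`, `[𝔞_{Q'}] = γ[𝔞_Q]`: extend `s = θ(γ)` to `σ ∈ Aut(ℂ/K)`
  (`exists_ringEquiv_restrict_eq`), transport the level-`N` structure of `τ_Q` to that of a representative `Q'`
  (`exists_levelTransport_of_apply_sqrtDisc_eq`, `HeegnerDatum.exists_isGamma0Equiv`,
  `LevelTransport.of_gamma0_smul_eq_right` — Gross 1984 §I.1 run through `Aut(ℂ)`), read off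
  `σ(φ(τ_Q)) = φ(τ_{Q'})` (equivariance) and `σ(j(τ_Q)) = j(τ_{Q'})` (`LevelTransport.apply_kleinJ_eq_and`), and
  compare with `σ(j([𝔞_Q])) = j(η(s)[𝔞_Q]) = j(γ[𝔞_Q])` (`ringEquiv_apply_classJ`; `j` is injective on classes,
  `classJ_injective`).

## References

* [Darmon2004] H. Darmon, *Rational Points on Modular Elliptic Curves*, CBMS 101 (2004): Thm. 3.3 (PDF p. 41),
  Thm. 3.6 (PDF pp. 43–44), Thm. 3.7 (PDF p. 44) (held `paper:doi-10-1090-cbms-101`).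
* [Gross1984] B. H. Gross, *Heegner points on `X₀(N)`* (1984), §I.1, §4 (4.2) (not held; through Darmon 2004).
* [GrossZagier1986] B. Gross, D. Zagier, Invent. Math. 84 (1986), II §1 pp. 235–236.
* [Cox2013] D. A. Cox, *Primes of the form x² + ny²*, 2nd ed. (2013): Thm. 7.7, (10.26), Thm. 11.1.
-/

noncomputable section

open scoped Classical MatrixGroups

open Complex UpperHalfPlane CongruenceSubgroup PeriodPair
  Literature.NumberTheory.EllipticCurves.ModularForms
  Literature.NumberTheory.QuadraticFields.BinaryQuadraticForm
  Literature.NumberTheory.QuadraticFields.Quadratic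
  Literature.Computability.Cryptography.Hallgren2005
  Literature.Computability.Cryptography.Hallgren2005.OrderCl

universe u

namespace Literature.NumberTheory.EllipticCurves

/-! ### The discharge -/

section Discharge

open ModularForms

variable (N : ℕ) [NeZero N] (W : WeierstrassCurve ℚ) (K : Type u) [Field K] [NumberField K]

/-- **Discharge of `heegnerPoints_shimuraReciprocity`** (Darmon 2004 Thm. 3.6 + Thm. 3.7 with Thm. 3.3; Gross 1984
§I.1, (4.2); Gross–Zagier 1986 II §1): for the Heegner points of conductor `1` on `X₀(N)` the lifts `P_Q ∈ E(H_K)` of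
the `φ(τ_Q)` (`exists_point_of_isAutEquivariantOnHeegner`, from the `Aut(ℂ)`-equivariance of `φ`,
`isAutEquivariantOnHeegner`) and the ISOMORPHISM `θ = η⁻¹ : Cl(𝒪_{d_K}) ≃* Gal(H_K/K)` (`galClassEquiv`, Hasse's
`η` built class-field-theory-free in `SingularModuliClassGroupAction.lean`) satisfy the transport law: for every
class `γ` and representative `Q`, extending `θ(γ)` to `σ ∈ Aut(ℂ/K)` (`exists_ringEquiv_restrict_eq`) and
transporting the level-`N` structure of `τ_Q` (`exists_levelTransport_of_apply_sqrtDisc_eq`) gives a representative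
`Q'` with `σ(φ(τ_Q)) = φ(τ_{Q'})`, whence `θ(γ) P_Q = P_{Q'}`, and `σ(j(τ_Q)) = j(τ_{Q'})`, whence
`[𝔞_{Q'}] = η(θ γ)·[𝔞_Q] = γ·[𝔞_Q]` (`ringEquiv_apply_classJ`). Net Literature debt `−1`.
[cite: Darmon2004, Thm. 3.3, Thm. 3.6, Thm. 3.7 (PDF pp. 41–44)] [cite: Gross1984, §I.1 and §4 (4.2)]
[cite: GrossZagier1986, II §1 (pp. 235–236)] -/
theorem heegnerPoints_shimuraReciprocity_holds : heegnerPoints_shimuraReciprocity N W K := by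
  intro _ hK hH Dt H ι
  have hND : IsCoprime (N : ℤ) (NumberField.discr K) := by
    have h := Literature.SatisfiesHeegnerHypothesis.coprime_discr hK.1 hH
    refine Int.isCoprime_iff_gcd_eq_one.mpr ?_
    rw [Int.gcd_eq_natAbs, Int.natAbs_natCast]
    exact h
  have hφ : Dt.IsAutEquivariantOnHeegner (NumberField.discr K) :=
    ModularParametrizationData.isAutEquivariantOnHeegner Dt _
  -- the lifts (Thm. 3.6)
  choose P hP using fun q : H.reps ↦ exists_point_of_isAutEquivariantOnHeegner hK hH Dt hφ ι
    H.dvd_sq_sub (H.mem_heegnerForms q q.2).1 (H.mem_heegnerForms q q.2).2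
  refine ⟨P, (galClassEquiv hK ι).symm, hP, fun γ q ↦ ?_⟩
  -- extend `θ(γ)` to `Aut(ℂ/K)` and transport the level structure of `τ_q`
  set s : singularModuliField K ι ≃ₐ[K] singularModuliField K ι := (galClassEquiv hK ι).symm γ with hs
  obtain ⟨σ, hσF, hσK⟩ := exists_ringEquiv_restrict_eq hK ι s
  have hσD := apply_sqrtDisc_discr_eq hK ι hσK
  obtain ⟨hq, hqβ⟩ := H.mem_heegnerForms q q.2
  obtain ⟨Q', hQ', hβ', hT⟩ := exists_levelTransport_of_apply_sqrtDisc_eq hK hND H.dvd_sq_sub hσD hq hqβ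
  obtain ⟨r, hr, γ₀, hγ₀⟩ := H.exists_isGamma0Equiv Q' hQ' hβ'
  have hT' : LevelTransport N σ (heegnerTau q) (heegnerTau r) :=
    hT.of_gamma0_smul_eq_right (γ := γ₀) (by rw [← hγ₀, Subgroup.smul_def])
  obtain ⟨hr', -⟩ := H.mem_heegnerForms r hr
  refine ⟨⟨r, hr⟩, ?_, ?_⟩
  · -- the class: `σ(j(τ_q)) = j(τ_r)` and `σ(j([q])) = j(γ[q])`
    have hqpp : (⟨q.1.1, q.1.2.1, q.1.2.2⟩ : BinQF).IsPosPrim hK.negDiscr.D :=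
      ⟨hq.1, hq.2.1, (BinQF.isPrimitive_iff _).mpr hq.2.2.2⟩
    have hrpp : (⟨r.1, r.2.1, r.2.2⟩ : BinQF).IsPosPrim hK.negDiscr.D :=
      ⟨hr'.1, hr'.2.1, (BinQF.isPrimitive_iff _).mpr hr'.2.2.2⟩
    have hj := hT'.apply_kleinJ_eq_and.1
    rw [← formJ_eq_kleinJ, ← formJ_eq_kleinJ, ← classJ_classOf'_triple hqpp, ← classJ_classOf'_triple hrpp,
      ringEquiv_apply_classJ hK ι s hσF, hs, galClass_galClassEquiv_symm] at hj
    rw [heegnerFormClass_def, heegnerFormClass_def]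
    exact (classJ_injective (discr_emod_four hK.1) hj).symm
  · -- the points: `σ(φ(τ_q)) = φ(τ_r)` and injectivity of `E(H_K) → E(ℂ)`
    apply WeierstrassCurve.Affine.Point.map_injective (f := (singularModuliField K ι).subtype.toRatAlgHom)
    rw [hP ⟨r, hr⟩, ← hφ σ hσD hq hr' hT', ← hP q, WeierstrassCurve.Affine.Point.map_map]
    have hswap : WeierstrassCurve.Affine.Point.map
        (s : singularModuliField K ι →ₐ[K] singularModuliField K ι) (P q) =
        WeierstrassCurve.Affine.Point.map
          (s : singularModuliField K ι ≃ₐ[K] singularModuliField K ι).toRingEquiv.toRingHom.toRatAlgHom (P q) :=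
      WeierstrassCurve.Affine.Point.map_congr_fun (fun _ ↦ rfl) _
    rw [hswap, WeierstrassCurve.Affine.Point.map_map]
    exact WeierstrassCurve.Affine.Point.map_congr_fun (fun x ↦ (hσF x).symm) _

end Discharge

end Literature.NumberTheory.EllipticCurves

end
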